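import Literature.AlgebraicGeometry.GroupSchemes.GroupChunkOfEverywhereDefinedLaw
import Literature.AlgebraicGeometry.GroupSchemes.SectionsThroughFibreDenseOpens
import Literature.AlgebraicGeometry.GroupSchemes.SectionSliceThroughFibreDenseOpens
import Mathlib.AlgebraicGeometry.Geometrically.Irreducible
import HarnessLib

/-!
# A strict birational group law defined everywhere has surjective — hence invertible — shear maps
# (Artin, *Néron models*, Lemma 2.5: «`φ`, `ψ` extend to automorphisms of `V′²`»)

Topic `Literature/AlgebraicGeometry/GroupSchemes`, namespace `Literature.AlgebraicGeometry.GroupSchemes`.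
KERNEL ONLY: theorems; no definition, no named fact, no instance, no `sorry`.  Cell `hodgecm-mathlib` (D-0151),
road W (Néron capital), piece **(G4b)** of the node (G4) `GroupLawOfSaturated` of A-p06's W1c design
(`W1cProbe-v6`, [Artin1986NeronModels] Lemma 2.5, second half): once the law of composition of the saturated stage
`V′` is defined EVERYWHERE on `V′ ×_S V′` (first half of Lemma 2.5, the multiplication chart) and is again a STRICT
birational group law (Artin's property (2.2) for `V′`, Lemma 2.4), its two shear maps
`Φ : (a, b) ↦ (a, ab)` and `Ψ : (a, b) ↦ (ab, b)` — open immersions by definition of a birational group law — are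
SURJECTIVE, hence isomorphisms: «this shows that `φ`, `ψ` extend to automorphisms of `V′²`».

Setting: `𝒱 → S` universally open with geometrically irreducible fibres and Zariski-local sections dense in every
fibre (`hsec`, the hypothesis of [Artin1986NeronModels] Thm. (1.12)); `L` a birational group law on `𝒱` with
`dom = 𝒱 ×_S 𝒱` (`IsIso L.dom.ι`) which is strict (`L.IsStrict`: `im Φ` and `im Ψ` are dense in the fibres of both
projections).

* `BirationalGroupLaw.exists_section_slice_mem_lift_mem` — the «generic section» for TWO conditions at once: for
  points `a`, `c` of `𝒱` over the same point of `S` and opens `O₁`, `O₂ ⊆ 𝒱 ×_S 𝒱` dense in the fibre of `pr₁`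
  over `a`, resp. of `pr₂` over `c`, ONE section `y` with `(a, y) ∈ O₁` and `(y, c) ∈ O₂`
  (★ `exists_open_forall_section_slice_mem` + ★ `exists_open_forall_section_lift_mem` + irreducibility of the
  fibre + ★ `exists_section_apply_mem`).
* **`BirationalGroupLaw.surjective_shearLeft_of_isStrict`** — `Φ` is surjective.  Proof (Artin's
  «`(b′, c′) ↦ (b′⁻¹x)(x⁻¹c′)` defines `b⁻¹c` at any point», read at ONE point, no chart needed): given a point
  `w = (a, c)` of `𝒱 ×_S 𝒱`, choose a section `y` with `(a, y) ∈ im Φ` and `(y, c) ∈ im Φ`; on `κ(w)`-valued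
  points put `d := a⁻¹y`, `e := y⁻¹c` (second coordinates of `Φ⁻¹`) and `b := d e` (defined: `dom` is
  everything); then `a b = a (d e) = (a d) e = y e = c` by the associativity of `L`, i.e. `Φ(a, b) = (a, c) = w`.
* **`BirationalGroupLaw.surjective_shearRight_of_isStrict`** — `Ψ` is surjective (the mirror image:
  `a := (c y⁻¹)(y b⁻¹)` through `im Ψ`).
* `BirationalGroupLaw.isIso_shearLeft_of_isStrict`, `…shearRight…` — hence (★ W1d
  `GroupChunkOfEverywhereDefinedLaw.isIso_shearLeft/Right`) both shears are ISOMORPHISMS of `S`-schemes; and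
  `BirationalGroupLaw.exists_grpObj_of_isStrict_of_isIso_ι` — with a section, `𝒱` is a group scheme whose law
  restricts to `mul` and `(𝒱, 𝟙)` solves the group-chunk problem for `L` (★ W1d `isGroupChunkSolution_id`).

HC_CM is proved only modulo the 7 printed citations until rung 0 closes; banked leaf, no floor change.

## References
* [Artin1986NeronModels] M. Artin, *Néron models*, in *Arithmetic Geometry* (Cornell, Silverman eds.), Springer
  1986, §2, Lemma 2.5 and its proof (p. 223); (2.2) (p. 221); Thm. (1.12) (p. 217).
* [EdixhovenRomagny] B. Edixhoven, M. Romagny, *Group schemes out of birational group laws, Néron models*, Panor.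
  Synthèses 47 (2015), Def. 3.4 (2), Thm. 3.18 (2).
* [BLRNeronModels1990] S. Bosch, W. Lütkebohmert, M. Raynaud, *Néron Models* (1990), §5.1 Def. 1, §5.2.
-/

set_option autoImplicit false

noncomputable section

open CategoryTheory CategoryTheory.Limits AlgebraicGeometry TopologicalSpace Topology MonoidalCategory
  CartesianMonoidalCategory
open scoped MonObj CategoryTheory.Obj

namespace Literature.AlgebraicGeometry.GroupSchemes

universe u

variable {S : Scheme.{u}} {𝒱 : Over S}

namespace BirationalGroupLaw

variable (L : BirationalGroupLaw 𝒱)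

/-! ## §1. One section, two slice conditions -/

omit L in
/-- **A section generic for two slice conditions** ([Artin1986NeronModels] §2: «let `x` be a generic section»).
Let `𝒱 → S` be universally open with geometrically irreducible fibres and sections dense in every fibre (`hsec`).
For points `a`, `c` of `𝒱` over the same point of `S` and opens `O₁`, `O₂ ⊆ 𝒱 ×_S 𝒱` with `O₁` dense in the fibre
of `pr₁` over `a` and `O₂` dense in the fibre of `pr₂` over `c`, there is ONE section `y : S → 𝒱` with
`(a, y) := (𝟙, y ∘ π)(a) ∈ O₁` and `(y, c) := (y ∘ π, 𝟙)(c) ∈ O₂`.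
[cite: Artin1986NeronModels, §2, proof of Lemma 2.5 (p. 223) and Thm. (1.12) (p. 217)]
[cite: EdixhovenRomagny, Def. 3.4 (2)] -/
theorem exists_section_slice_mem_lift_mem [UniversallyOpen 𝒱.hom] [GeometricallyIrreducible 𝒱.hom]
    (hsec : ∀ (x : 𝒱.left) (Ω : 𝒱.left.Opens), x ∈ Ω →
      ∃ a : S ⟶ 𝒱.left, a ≫ 𝒱.hom = 𝟙 S ∧ ∃ s : S, a.base s ∈ Ω ∧ 𝒱.hom.base (a.base s) = 𝒱.hom.base x)
    (a c : 𝒱.left) (hac : 𝒱.hom.base a = 𝒱.hom.base c)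
    (O₁ O₂ : (pullback 𝒱.hom 𝒱.hom).Opens)
    (h₁ : (pullback.fst 𝒱.hom 𝒱.hom) ⁻¹' {a} ⊆
      closure ((O₁ : Set ↑(pullback 𝒱.hom 𝒱.hom)) ∩ (pullback.fst 𝒱.hom 𝒱.hom) ⁻¹' {a}))
    (h₂ : (pullback.snd 𝒱.hom 𝒱.hom) ⁻¹' {c} ⊆
      closure ((O₂ : Set ↑(pullback 𝒱.hom 𝒱.hom)) ∩ (pullback.snd 𝒱.hom 𝒱.hom) ⁻¹' {c})) :
    ∃ (y : S ⟶ 𝒱.left) (hy : y ≫ 𝒱.hom = 𝟙 S),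
      pullback.lift (𝟙 𝒱.left) (𝒱.hom ≫ y)
          (by rw [Category.assoc, hy, Category.comp_id, Category.id_comp]) a ∈ O₁ ∧
      pullback.lift (𝒱.hom ≫ y) (𝟙 𝒱.left)
          (by rw [Category.assoc, hy, Category.comp_id, Category.id_comp]) c ∈ O₂ := by
  -- the fibre of `𝒱 → S` over `t = π a = π c` is irreducible
  have hirr : IsIrreducible (𝒱.hom.base ⁻¹' {𝒱.hom.base a}) :=
    𝒱.hom.isIrreducible_preimage 𝒱.hom.isOpenMap isIrreducible_singleton
  -- (i) `(a, y) ∈ O₁` on an open `Ω₁` of values `y(t)`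
  obtain ⟨Ω₁, hΩ₁ne, hΩ₁⟩ := exists_open_forall_section_slice_mem 𝒱.hom 𝒱.hom a O₁ h₁ ⟨a, rfl⟩
  -- (ii) `(y, c) ∈ O₂` on an open `Ω₂`
  obtain ⟨Ω₂, hΩ₂ne, hΩ₂⟩ := exists_open_forall_section_lift_mem 𝒱.hom 𝒱.hom c O₂ h₂ ⟨c, rfl⟩
  -- the two opens meet the (irreducible) fibre over `t` simultaneously
  change ((Ω₁ : Set 𝒱.left) ∩ 𝒱.hom.base ⁻¹' {𝒱.hom.base a}).Nonempty at hΩ₁ne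
  change ((Ω₂ : Set 𝒱.left) ∩ 𝒱.hom.base ⁻¹' {𝒱.hom.base c}).Nonempty at hΩ₂ne
  rw [← hac] at hΩ₂ne
  have h12 : ((𝒱.hom.base ⁻¹' {𝒱.hom.base a}) ∩ ((Ω₁ : Set 𝒱.left) ∩ Ω₂)).Nonempty :=
    hirr.isPreirreducible _ _ Ω₁.isOpen Ω₂.isOpen (by rwa [Set.inter_comm]) (by rwa [Set.inter_comm])
  obtain ⟨y, hy, hyΩ⟩ := exists_section_apply_mem 𝒱.hom hsec (𝒱.hom.base a) (Ω₁ ⊓ Ω₂)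
    (by rw [Set.inter_comm] at h12; exact h12)
  have hy₁ : y.base (𝒱.hom.base a) ∈ Ω₁ := hyΩ.1
  have hy₂ : y.base (𝒱.hom.base c) ∈ Ω₂ := hac ▸ hyΩ.2
  exact ⟨y, hy, hΩ₁ y hy hy₁, hΩ₂ y hy hy₂⟩

/-! ## §2. The left shear is surjective -/

/-- **The left shear of a strict, everywhere-defined birational group law is surjective**
([Artin1986NeronModels] Lemma 2.5: «`(b′, c′) ↦ (b′⁻¹x)(x⁻¹c′)` … define[s] the law `b⁻¹c` at any point of `V′²`.
This shows that `φ` … extend[s] to [an] automorphism of `V′²`»).  For `𝒱 → S` universally open with geometrically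
irreducible fibres and fibrewise-dense sections, and `L` strict with `dom = 𝒱 ×_S 𝒱`: every point `(a, c)` of
`𝒱 ×_S 𝒱` is `Φ(a, b) = (a, ab)` — with `b = (a⁻¹y)(y⁻¹c)` for a section `y` such that `(a, y)`, `(y, c) ∈ im Φ`,
by associativity `a((a⁻¹y)(y⁻¹c)) = (a(a⁻¹y))(y⁻¹c) = y(y⁻¹c) = c`.
[cite: Artin1986NeronModels, Lemma 2.5 and its proof (p. 223)] [cite: EdixhovenRomagny, Thm. 3.18 (2)] -/
theorem surjective_shearLeft_of_isStrict [IsIso L.dom.ι] [UniversallyOpen 𝒱.hom] [GeometricallyIrreducible 𝒱.hom]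
    (hL : L.IsStrict)
    (hsec : ∀ (x : 𝒱.left) (Ω : 𝒱.left.Opens), x ∈ Ω →
      ∃ a : S ⟶ 𝒱.left, a ≫ 𝒱.hom = 𝟙 S ∧ ∃ s : S, a.base s ∈ Ω ∧ 𝒱.hom.base (a.base s) = 𝒱.hom.base x) :
    Function.Surjective L.shearLeft.left.base := by
  intro w
  -- the shear `Φ = (pr₁, mul) : dom → 𝒱 ×_S 𝒱`
  set Φ : (L.dom : Scheme.{u}) ⟶ (𝒱 ⊗ 𝒱).left := L.shearLeft.left with hΦdef
  haveI hΦo : IsOpenImmersion Φ := L.isOpenImmersion_shearLeft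
  have hΦ1 : Φ ≫ (fst 𝒱 𝒱).left = L.dom.ι ≫ (fst 𝒱 𝒱).left :=
    congrArg CommaMorphism.left (LawData.shearLeft_fst 𝒱 L.dom L.mul L.mul_comp)
  have hΦ2 : Φ ≫ (snd 𝒱 𝒱).left = L.mul :=
    congrArg CommaMorphism.left (LawData.shearLeft_snd 𝒱 L.dom L.mul L.mul_comp)
  have hfstS : (fst 𝒱 𝒱).left ≫ 𝒱.hom = (𝒱 ⊗ 𝒱).hom := Over.w (fst 𝒱 𝒱)
  have hsndS : (snd 𝒱 𝒱).left ≫ 𝒱.hom = (𝒱 ⊗ 𝒱).hom := Over.w (snd 𝒱 𝒱)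
  have hext : ∀ {T : Scheme.{u}} (f g : T ⟶ (𝒱 ⊗ 𝒱).left),
      f ≫ (fst 𝒱 𝒱).left = g ≫ (fst 𝒱 𝒱).left → f ≫ (snd 𝒱 𝒱).left = g ≫ (snd 𝒱 𝒱).left → f = g :=
    fun f g h1 h2 => pullback.hom_ext h1 h2
  -- the coordinates `a₀`, `c₀` of `w` and the base point `t`
  set a₀ : 𝒱.left := (fst 𝒱 𝒱).left.base w with ha₀def
  set c₀ : 𝒱.left := (snd 𝒱 𝒱).left.base w with hc₀def
  have hac : 𝒱.hom.base a₀ = 𝒱.hom.base c₀ := by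
    change ((fst 𝒱 𝒱).left ≫ 𝒱.hom).base w = ((snd 𝒱 𝒱).left ≫ 𝒱.hom).base w
    rw [hfstS, hsndS]
  -- ONE section `y` with `(a₀, y) ∈ im Φ` and `(y, c₀) ∈ im Φ` (`im Φ` is dense in the fibres of both projections
  -- by strictness); the two slices `σ₁ = (𝟙, y∘π)`, `σ₂ = (y∘π, 𝟙)`
  obtain ⟨y, hy, hya, hyc⟩ := exists_section_slice_mem_lift_mem hsec a₀ c₀ hac
    (Φ.opensRange : (pullback 𝒱.hom 𝒱.hom).Opens) (Φ.opensRange : (pullback 𝒱.hom 𝒱.hom).Opens)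
    (hL.2.1.1 a₀) (hL.2.1.2 c₀)
  obtain ⟨σ₁, hσ₁1, hσ₁2, hσ₁a⟩ : ∃ σ : 𝒱.left ⟶ (𝒱 ⊗ 𝒱).left, σ ≫ (fst 𝒱 𝒱).left = 𝟙 _ ∧
      σ ≫ (snd 𝒱 𝒱).left = 𝒱.hom ≫ y ∧ σ.base a₀ ∈ Set.range Φ.base :=
    ⟨pullback.lift (𝟙 𝒱.left) (𝒱.hom ≫ y) (by rw [Category.assoc, hy, Category.comp_id, Category.id_comp]),
      pullback.lift_fst _ _ _, pullback.lift_snd _ _ _, hya⟩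
  obtain ⟨σ₂, hσ₂1, hσ₂2, hσ₂c⟩ : ∃ σ : 𝒱.left ⟶ (𝒱 ⊗ 𝒱).left, σ ≫ (fst 𝒱 𝒱).left = 𝒱.hom ≫ y ∧
      σ ≫ (snd 𝒱 𝒱).left = 𝟙 _ ∧ σ.base c₀ ∈ Set.range Φ.base :=
    ⟨pullback.lift (𝒱.hom ≫ y) (𝟙 𝒱.left) (by rw [Category.assoc, hy, Category.comp_id, Category.id_comp]),
      pullback.lift_fst _ _ _, pullback.lift_snd _ _ _, hyc⟩
  -- the `κ(w)`-valued point `ω = (a, c)` of `𝒱 ×_S 𝒱`, over `τ : Spec κ(w) → S`, and `yT = y ∘ τ`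
  set T : Scheme.{u} := Spec ((𝒱 ⊗ 𝒱).left.residueField w) with hTdef
  set ω : T ⟶ (𝒱 ⊗ 𝒱).left := (𝒱 ⊗ 𝒱).left.fromSpecResidueField w with hωdef
  have hω : ∀ p : T, ω.base p = w := fun p => (𝒱 ⊗ 𝒱).left.fromSpecResidueField_apply w p
  set a : T ⟶ 𝒱.left := ω ≫ (fst 𝒱 𝒱).left with hadef
  set c : T ⟶ 𝒱.left := ω ≫ (snd 𝒱 𝒱).left with hcdef
  set τ : T ⟶ S := ω ≫ (𝒱 ⊗ 𝒱).hom with hτdef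
  set yT : T ⟶ 𝒱.left := τ ≫ y with hyTdef
  have haS : a ≫ 𝒱.hom = τ := by rw [hadef, Category.assoc, hfstS]
  have hcS : c ≫ 𝒱.hom = τ := by rw [hcdef, Category.assoc, hsndS]
  have hyS : yT ≫ 𝒱.hom = τ := by rw [hyTdef, Category.assoc, hy, Category.comp_id]
  -- every `T`-point of `dom` whose first coordinate lies over `τ` has second coordinate and product over `τ`
  have hcoordS : ∀ (q : T ⟶ (L.dom : Scheme.{u})), (q ≫ L.dom.ι ≫ (fst 𝒱 𝒱).left) ≫ 𝒱.hom = τ →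
      (q ≫ L.dom.ι ≫ (snd 𝒱 𝒱).left) ≫ 𝒱.hom = τ ∧ (q ≫ L.mul) ≫ 𝒱.hom = τ := by
    intro q hq
    simp only [Category.assoc] at hq ⊢
    refine ⟨?_, ?_⟩
    · rw [hsndS, ← hfstS]; exact hq
    · rw [L.mul_comp, ← hfstS]; exact hq
  -- (1) `p₁ = (a, y)` lies in `im Φ`: `d := a⁻¹y`
  obtain ⟨p₁, hp₁1, hp₁2⟩ : ∃ p : T ⟶ (𝒱 ⊗ 𝒱).left, p ≫ (fst 𝒱 𝒱).left = a ∧ p ≫ (snd 𝒱 𝒱).left = yT :=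
    ⟨pullback.lift a yT (haS.trans hyS.symm), pullback.lift_fst _ _ _, pullback.lift_snd _ _ _⟩
  have hp₁eq : a ≫ σ₁ = p₁ := by
    refine hext _ _ ?_ ?_
    · rw [Category.assoc, hσ₁1, Category.comp_id, hp₁1]
    · rw [Category.assoc, hσ₁2, reassoc_of% haS, hp₁2]
  have hr₁ : Set.range p₁.base ⊆ Set.range Φ.base := by
    rintro _ ⟨p, rfl⟩
    rw [← hp₁eq, Scheme.Hom.comp_base, TopCat.comp_app, hadef, Scheme.Hom.comp_base, TopCat.comp_app, hω p]
    exact hσ₁a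
  obtain ⟨q₁, hq₁⟩ : ∃ q₁ : T ⟶ (L.dom : Scheme.{u}), q₁ ≫ Φ = p₁ :=
    ⟨IsOpenImmersion.lift Φ p₁ hr₁, IsOpenImmersion.lift_fac _ _ _⟩
  set d : T ⟶ 𝒱.left := q₁ ≫ L.dom.ι ≫ (snd 𝒱 𝒱).left with hddef
  have hC₁ : LawData.Computes 𝒱 L.dom L.mul q₁ a d yT := by
    refine ⟨?_, rfl, ?_⟩
    · rw [← hΦ1, reassoc_of% hq₁, hp₁1]
    · rw [← hΦ2, reassoc_of% hq₁, hp₁2]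
  -- (2) `p₂ = (y, c)` lies in `im Φ`: `e := y⁻¹c`
  obtain ⟨p₂, hp₂1, hp₂2⟩ : ∃ p : T ⟶ (𝒱 ⊗ 𝒱).left, p ≫ (fst 𝒱 𝒱).left = yT ∧ p ≫ (snd 𝒱 𝒱).left = c :=
    ⟨pullback.lift yT c (hyS.trans hcS.symm), pullback.lift_fst _ _ _, pullback.lift_snd _ _ _⟩
  have hp₂eq : c ≫ σ₂ = p₂ := by
    refine hext _ _ ?_ ?_
    · rw [Category.assoc, hσ₂1, reassoc_of% hcS, hp₂1]
    · rw [Category.assoc, hσ₂2, Category.comp_id, hp₂2]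
  have hr₂ : Set.range p₂.base ⊆ Set.range Φ.base := by
    rintro _ ⟨p, rfl⟩
    rw [← hp₂eq, Scheme.Hom.comp_base, TopCat.comp_app, hcdef, Scheme.Hom.comp_base, TopCat.comp_app, hω p]
    exact hσ₂c
  obtain ⟨q₂, hq₂⟩ : ∃ q₂ : T ⟶ (L.dom : Scheme.{u}), q₂ ≫ Φ = p₂ :=
    ⟨IsOpenImmersion.lift Φ p₂ hr₂, IsOpenImmersion.lift_fac _ _ _⟩
  set e : T ⟶ 𝒱.left := q₂ ≫ L.dom.ι ≫ (snd 𝒱 𝒱).left with hedef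
  have hC₂ : LawData.Computes 𝒱 L.dom L.mul q₂ yT e c := by
    refine ⟨?_, rfl, ?_⟩
    · rw [← hΦ1, reassoc_of% hq₂, hp₂1]
    · rw [← hΦ2, reassoc_of% hq₂, hp₂2]
  -- (3) `b := d e` (defined: `dom` is everything)
  have hdS : d ≫ 𝒱.hom = τ := (hcoordS q₁ (by rw [hC₁.1, haS])).1
  have heS : e ≫ 𝒱.hom = τ := (hcoordS q₂ (by rw [hC₂.1, hyS])).1
  obtain ⟨r₃, hr₃1, hr₃2⟩ : ∃ r : T ⟶ (𝒱 ⊗ 𝒱).left, r ≫ (fst 𝒱 𝒱).left = d ∧ r ≫ (snd 𝒱 𝒱).left = e :=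
    ⟨pullback.lift d e (hdS.trans heS.symm), pullback.lift_fst _ _ _, pullback.lift_snd _ _ _⟩
  set q₃ : T ⟶ (L.dom : Scheme.{u}) := r₃ ≫ inv L.dom.ι with hq₃def
  have hq₃ι : q₃ ≫ L.dom.ι = r₃ := by rw [hq₃def, Category.assoc, IsIso.inv_hom_id, Category.comp_id]
  set b : T ⟶ 𝒱.left := q₃ ≫ L.mul with hbdef
  have hC₃ : LawData.Computes 𝒱 L.dom L.mul q₃ d e b :=
    ⟨by rw [reassoc_of% hq₃ι, hr₃1], by rw [reassoc_of% hq₃ι, hr₃2], rfl⟩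
  -- (4) `ab`
  have hbS : b ≫ 𝒱.hom = τ := (hcoordS q₃ (by rw [hC₃.1, hdS])).2
  obtain ⟨r₄, hr₄1, hr₄2⟩ : ∃ r : T ⟶ (𝒱 ⊗ 𝒱).left, r ≫ (fst 𝒱 𝒱).left = a ∧ r ≫ (snd 𝒱 𝒱).left = b :=
    ⟨pullback.lift a b (haS.trans hbS.symm), pullback.lift_fst _ _ _, pullback.lift_snd _ _ _⟩
  set q₄ : T ⟶ (L.dom : Scheme.{u}) := r₄ ≫ inv L.dom.ι with hq₄def
  have hq₄ι : q₄ ≫ L.dom.ι = r₄ := by rw [hq₄def, Category.assoc, IsIso.inv_hom_id, Category.comp_id]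
  have hC₄ : LawData.Computes 𝒱 L.dom L.mul q₄ a b (q₄ ≫ L.mul) :=
    ⟨by rw [reassoc_of% hq₄ι, hr₄1], by rw [reassoc_of% hq₄ι, hr₄2], rfl⟩
  -- ASSOCIATIVITY: `a (d e) = (a d) e = y e = c`
  have key : c = q₄ ≫ L.mul := L.assoc hC₁ hC₃ hC₂ hC₄
  -- hence `Φ(a, b) = (a, c) = ω`
  have hq₄Φ : q₄ ≫ Φ = ω := by
    refine hext _ _ ?_ ?_
    · rw [Category.assoc, hΦ1, reassoc_of% hq₄ι, hr₄1]
    · rw [Category.assoc, hΦ2, ← key]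
  obtain ⟨p⟩ : Nonempty T := inferInstance
  refine ⟨q₄.base p, ?_⟩
  rw [← hω p, ← hq₄Φ]
  rfl

/-! ## §3. The right shear is surjective -/

/-- **The right shear of a strict, everywhere-defined birational group law is surjective**
([Artin1986NeronModels] Lemma 2.5: «`(a′, c′) ↦ (c′x⁻¹)(xa′⁻¹)` define[s] the law `ca⁻¹` at any point of `V′²` …
`ψ` extend[s] to [an] automorphism»), the mirror image of `surjective_shearLeft_of_isStrict`: every point `(c, b)` of
`𝒱 ×_S 𝒱` is `Ψ(a, b) = (ab, b)` with `a = (c y⁻¹)(y b⁻¹)` for a section `y` such that `(c, y)`, `(y, b) ∈ im Ψ`,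
by associativity `((c y⁻¹)(y b⁻¹)) b = (c y⁻¹)((y b⁻¹) b) = (c y⁻¹) y = c`.
[cite: Artin1986NeronModels, Lemma 2.5 and its proof (p. 223)] [cite: EdixhovenRomagny, Thm. 3.18 (2)] -/
theorem surjective_shearRight_of_isStrict [IsIso L.dom.ι] [UniversallyOpen 𝒱.hom] [GeometricallyIrreducible 𝒱.hom]
    (hL : L.IsStrict)
    (hsec : ∀ (x : 𝒱.left) (Ω : 𝒱.left.Opens), x ∈ Ω →
      ∃ a : S ⟶ 𝒱.left, a ≫ 𝒱.hom = 𝟙 S ∧ ∃ s : S, a.base s ∈ Ω ∧ 𝒱.hom.base (a.base s) = 𝒱.hom.base x) :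
    Function.Surjective L.shearRight.left.base := by
  intro w
  -- the shear `Ψ = (mul, pr₂) : dom → 𝒱 ×_S 𝒱`
  set Ψ : (L.dom : Scheme.{u}) ⟶ (𝒱 ⊗ 𝒱).left := L.shearRight.left with hΨdef
  haveI hΨo : IsOpenImmersion Ψ := L.isOpenImmersion_shearRight
  have hΨ1 : Ψ ≫ (fst 𝒱 𝒱).left = L.mul :=
    congrArg CommaMorphism.left (LawData.shearRight_fst 𝒱 L.dom L.mul L.mul_comp)
  have hΨ2 : Ψ ≫ (snd 𝒱 𝒱).left = L.dom.ι ≫ (snd 𝒱 𝒱).left :=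
    congrArg CommaMorphism.left (LawData.shearRight_snd 𝒱 L.dom L.mul L.mul_comp)
  have hfstS : (fst 𝒱 𝒱).left ≫ 𝒱.hom = (𝒱 ⊗ 𝒱).hom := Over.w (fst 𝒱 𝒱)
  have hsndS : (snd 𝒱 𝒱).left ≫ 𝒱.hom = (𝒱 ⊗ 𝒱).hom := Over.w (snd 𝒱 𝒱)
  have hext : ∀ {T : Scheme.{u}} (f g : T ⟶ (𝒱 ⊗ 𝒱).left),
      f ≫ (fst 𝒱 𝒱).left = g ≫ (fst 𝒱 𝒱).left → f ≫ (snd 𝒱 𝒱).left = g ≫ (snd 𝒱 𝒱).left → f = g :=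
    fun f g h1 h2 => pullback.hom_ext h1 h2
  -- the coordinates `c₀`, `b₀` of `w` and the base point `t`
  set c₀ : 𝒱.left := (fst 𝒱 𝒱).left.base w with hc₀def
  set b₀ : 𝒱.left := (snd 𝒱 𝒱).left.base w with hb₀def
  have hcb : 𝒱.hom.base c₀ = 𝒱.hom.base b₀ := by
    change ((fst 𝒱 𝒱).left ≫ 𝒱.hom).base w = ((snd 𝒱 𝒱).left ≫ 𝒱.hom).base w
    rw [hfstS, hsndS]
  -- ONE section `y` with `(c₀, y) ∈ im Ψ` and `(y, b₀) ∈ im Ψ` (`im Ψ` is dense in the fibres of both projections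
  -- by strictness); the two slices `σ₁ = (𝟙, y∘π)`, `σ₂ = (y∘π, 𝟙)`
  obtain ⟨y, hy, hyc, hyb⟩ := exists_section_slice_mem_lift_mem hsec c₀ b₀ hcb
    (Ψ.opensRange : (pullback 𝒱.hom 𝒱.hom).Opens) (Ψ.opensRange : (pullback 𝒱.hom 𝒱.hom).Opens)
    (hL.2.2.1 c₀) (hL.2.2.2 b₀)
  obtain ⟨σ₁, hσ₁1, hσ₁2, hσ₁c⟩ : ∃ σ : 𝒱.left ⟶ (𝒱 ⊗ 𝒱).left, σ ≫ (fst 𝒱 𝒱).left = 𝟙 _ ∧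
      σ ≫ (snd 𝒱 𝒱).left = 𝒱.hom ≫ y ∧ σ.base c₀ ∈ Set.range Ψ.base :=
    ⟨pullback.lift (𝟙 𝒱.left) (𝒱.hom ≫ y) (by rw [Category.assoc, hy, Category.comp_id, Category.id_comp]),
      pullback.lift_fst _ _ _, pullback.lift_snd _ _ _, hyc⟩
  obtain ⟨σ₂, hσ₂1, hσ₂2, hσ₂b⟩ : ∃ σ : 𝒱.left ⟶ (𝒱 ⊗ 𝒱).left, σ ≫ (fst 𝒱 𝒱).left = 𝒱.hom ≫ y ∧
      σ ≫ (snd 𝒱 𝒱).left = 𝟙 _ ∧ σ.base b₀ ∈ Set.range Ψ.base :=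
    ⟨pullback.lift (𝒱.hom ≫ y) (𝟙 𝒱.left) (by rw [Category.assoc, hy, Category.comp_id, Category.id_comp]),
      pullback.lift_fst _ _ _, pullback.lift_snd _ _ _, hyb⟩
  -- the `κ(w)`-valued point `ω = (c, b)` of `𝒱 ×_S 𝒱`, over `τ : Spec κ(w) → S`, and `yT = y ∘ τ`
  set T : Scheme.{u} := Spec ((𝒱 ⊗ 𝒱).left.residueField w) with hTdef
  set ω : T ⟶ (𝒱 ⊗ 𝒱).left := (𝒱 ⊗ 𝒱).left.fromSpecResidueField w with hωdef
  have hω : ∀ p : T, ω.base p = w := fun p => (𝒱 ⊗ 𝒱).left.fromSpecResidueField_apply w p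
  set c : T ⟶ 𝒱.left := ω ≫ (fst 𝒱 𝒱).left with hcdef
  set b : T ⟶ 𝒱.left := ω ≫ (snd 𝒱 𝒱).left with hbdef
  set τ : T ⟶ S := ω ≫ (𝒱 ⊗ 𝒱).hom with hτdef
  set yT : T ⟶ 𝒱.left := τ ≫ y with hyTdef
  have hcS : c ≫ 𝒱.hom = τ := by rw [hcdef, Category.assoc, hfstS]
  have hbS : b ≫ 𝒱.hom = τ := by rw [hbdef, Category.assoc, hsndS]
  have hyS : yT ≫ 𝒱.hom = τ := by rw [hyTdef, Category.assoc, hy, Category.comp_id]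
  -- every `T`-point of `dom` whose second coordinate lies over `τ` has first coordinate and product over `τ`
  have hcoordS : ∀ (q : T ⟶ (L.dom : Scheme.{u})), (q ≫ L.dom.ι ≫ (snd 𝒱 𝒱).left) ≫ 𝒱.hom = τ →
      (q ≫ L.dom.ι ≫ (fst 𝒱 𝒱).left) ≫ 𝒱.hom = τ ∧ (q ≫ L.mul) ≫ 𝒱.hom = τ := by
    intro q hq
    simp only [Category.assoc] at hq ⊢
    rw [hsndS] at hq
    refine ⟨?_, ?_⟩
    · rw [hfstS]; exact hq
    · rw [L.mul_comp]; exact hq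
  -- (1) `p₁ = (c, y)` lies in `im Ψ`: `d := c y⁻¹`
  obtain ⟨p₁, hp₁1, hp₁2⟩ : ∃ p : T ⟶ (𝒱 ⊗ 𝒱).left, p ≫ (fst 𝒱 𝒱).left = c ∧ p ≫ (snd 𝒱 𝒱).left = yT :=
    ⟨pullback.lift c yT (hcS.trans hyS.symm), pullback.lift_fst _ _ _, pullback.lift_snd _ _ _⟩
  have hp₁eq : c ≫ σ₁ = p₁ := by
    refine hext _ _ ?_ ?_
    · rw [Category.assoc, hσ₁1, Category.comp_id, hp₁1]
    · rw [Category.assoc, hσ₁2, reassoc_of% hcS, hp₁2]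
  have hr₁ : Set.range p₁.base ⊆ Set.range Ψ.base := by
    rintro _ ⟨p, rfl⟩
    rw [← hp₁eq, Scheme.Hom.comp_base, TopCat.comp_app, hcdef, Scheme.Hom.comp_base, TopCat.comp_app, hω p]
    exact hσ₁c
  obtain ⟨q₁, hq₁⟩ : ∃ q₁ : T ⟶ (L.dom : Scheme.{u}), q₁ ≫ Ψ = p₁ :=
    ⟨IsOpenImmersion.lift Ψ p₁ hr₁, IsOpenImmersion.lift_fac _ _ _⟩
  set d : T ⟶ 𝒱.left := q₁ ≫ L.dom.ι ≫ (fst 𝒱 𝒱).left with hddef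
  have hC₁ : LawData.Computes 𝒱 L.dom L.mul q₁ d yT c := by
    refine ⟨rfl, ?_, ?_⟩
    · rw [← hΨ2, reassoc_of% hq₁, hp₁2]
    · rw [← hΨ1, reassoc_of% hq₁, hp₁1]
  -- (2) `p₂ = (y, b)` lies in `im Ψ`: `g := y b⁻¹`
  obtain ⟨p₂, hp₂1, hp₂2⟩ : ∃ p : T ⟶ (𝒱 ⊗ 𝒱).left, p ≫ (fst 𝒱 𝒱).left = yT ∧ p ≫ (snd 𝒱 𝒱).left = b :=
    ⟨pullback.lift yT b (hyS.trans hbS.symm), pullback.lift_fst _ _ _, pullback.lift_snd _ _ _⟩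
  have hp₂eq : b ≫ σ₂ = p₂ := by
    refine hext _ _ ?_ ?_
    · rw [Category.assoc, hσ₂1, reassoc_of% hbS, hp₂1]
    · rw [Category.assoc, hσ₂2, Category.comp_id, hp₂2]
  have hr₂ : Set.range p₂.base ⊆ Set.range Ψ.base := by
    rintro _ ⟨p, rfl⟩
    rw [← hp₂eq, Scheme.Hom.comp_base, TopCat.comp_app, hbdef, Scheme.Hom.comp_base, TopCat.comp_app, hω p]
    exact hσ₂b
  obtain ⟨q₂, hq₂⟩ : ∃ q₂ : T ⟶ (L.dom : Scheme.{u}), q₂ ≫ Ψ = p₂ :=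
    ⟨IsOpenImmersion.lift Ψ p₂ hr₂, IsOpenImmersion.lift_fac _ _ _⟩
  set g : T ⟶ 𝒱.left := q₂ ≫ L.dom.ι ≫ (fst 𝒱 𝒱).left with hgdef
  have hC₂ : LawData.Computes 𝒱 L.dom L.mul q₂ g b yT := by
    refine ⟨rfl, ?_, ?_⟩
    · rw [← hΨ2, reassoc_of% hq₂, hp₂2]
    · rw [← hΨ1, reassoc_of% hq₂, hp₂1]
  -- (3) `a := d g` (defined: `dom` is everything)
  have hdS : d ≫ 𝒱.hom = τ := (hcoordS q₁ (by rw [hC₁.2.1, hyS])).1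
  have hgS : g ≫ 𝒱.hom = τ := (hcoordS q₂ (by rw [hC₂.2.1, hbS])).1
  obtain ⟨r₃, hr₃1, hr₃2⟩ : ∃ r : T ⟶ (𝒱 ⊗ 𝒱).left, r ≫ (fst 𝒱 𝒱).left = d ∧ r ≫ (snd 𝒱 𝒱).left = g :=
    ⟨pullback.lift d g (hdS.trans hgS.symm), pullback.lift_fst _ _ _, pullback.lift_snd _ _ _⟩
  set q₃ : T ⟶ (L.dom : Scheme.{u}) := r₃ ≫ inv L.dom.ι with hq₃def
  have hq₃ι : q₃ ≫ L.dom.ι = r₃ := by rw [hq₃def, Category.assoc, IsIso.inv_hom_id, Category.comp_id]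
  set a : T ⟶ 𝒱.left := q₃ ≫ L.mul with hadef
  have hC₃ : LawData.Computes 𝒱 L.dom L.mul q₃ d g a :=
    ⟨by rw [reassoc_of% hq₃ι, hr₃1], by rw [reassoc_of% hq₃ι, hr₃2], rfl⟩
  -- (4) `ab`
  have haS : a ≫ 𝒱.hom = τ := (hcoordS q₃ (by rw [hC₃.2.1, hgS])).2
  obtain ⟨r₄, hr₄1, hr₄2⟩ : ∃ r : T ⟶ (𝒱 ⊗ 𝒱).left, r ≫ (fst 𝒱 𝒱).left = a ∧ r ≫ (snd 𝒱 𝒱).left = b :=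
    ⟨pullback.lift a b (haS.trans hbS.symm), pullback.lift_fst _ _ _, pullback.lift_snd _ _ _⟩
  set q₄ : T ⟶ (L.dom : Scheme.{u}) := r₄ ≫ inv L.dom.ι with hq₄def
  have hq₄ι : q₄ ≫ L.dom.ι = r₄ := by rw [hq₄def, Category.assoc, IsIso.inv_hom_id, Category.comp_id]
  have hC₄ : LawData.Computes 𝒱 L.dom L.mul q₄ a b (q₄ ≫ L.mul) :=
    ⟨by rw [reassoc_of% hq₄ι, hr₄1], by rw [reassoc_of% hq₄ι, hr₄2], rfl⟩
  -- ASSOCIATIVITY: `(d g) b = d (g b) = d y = c`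
  have key : q₄ ≫ L.mul = c := L.assoc hC₃ hC₂ hC₄ hC₁
  -- hence `Ψ(a, b) = (c, b) = ω`
  have hq₄Ψ : q₄ ≫ Ψ = ω := by
    refine hext _ _ ?_ ?_
    · rw [Category.assoc, hΨ1, key]
    · rw [Category.assoc, hΨ2, reassoc_of% hq₄ι, hr₄2]
  obtain ⟨p⟩ : Nonempty T := inferInstance
  refine ⟨q₄.base p, ?_⟩
  rw [← hω p, ← hq₄Ψ]
  rfl

/-! ## §4. The shears are isomorphisms; the law is a group law -/

/-- **«`φ` extends to an automorphism of `V′²`»** ([Artin1986NeronModels] Lemma 2.5): the left shear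
`Φ : (a, b) ↦ (a, ab)` of a strict, everywhere-defined birational group law (hypotheses of
`surjective_shearLeft_of_isStrict`) is an isomorphism of `S`-schemes — a surjective open immersion
(★ `isIso_shearLeft`). [cite: Artin1986NeronModels, Lemma 2.5 (p. 223)] [cite: EdixhovenRomagny, Thm. 3.18 (2)] -/
theorem isIso_shearLeft_of_isStrict [IsIso L.dom.ι] [UniversallyOpen 𝒱.hom] [GeometricallyIrreducible 𝒱.hom]
    (hL : L.IsStrict)
    (hsec : ∀ (x : 𝒱.left) (Ω : 𝒱.left.Opens), x ∈ Ω →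
      ∃ a : S ⟶ 𝒱.left, a ≫ 𝒱.hom = 𝟙 S ∧ ∃ s : S, a.base s ∈ Ω ∧ 𝒱.hom.base (a.base s) = 𝒱.hom.base x) :
    IsIso L.shearLeft :=
  L.isIso_shearLeft (L.surjective_shearLeft_of_isStrict hL hsec)

/-- **«`ψ` extends to an automorphism of `V′²`»** ([Artin1986NeronModels] Lemma 2.5): the right shear
`Ψ : (a, b) ↦ (ab, b)` of a strict, everywhere-defined birational group law is an isomorphism of `S`-schemes
(★ `isIso_shearRight`). [cite: Artin1986NeronModels, Lemma 2.5 (p. 223)] [cite: EdixhovenRomagny, Thm. 3.18 (2)] -/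
theorem isIso_shearRight_of_isStrict [IsIso L.dom.ι] [UniversallyOpen 𝒱.hom] [GeometricallyIrreducible 𝒱.hom]
    (hL : L.IsStrict)
    (hsec : ∀ (x : 𝒱.left) (Ω : 𝒱.left.Opens), x ∈ Ω →
      ∃ a : S ⟶ 𝒱.left, a ≫ 𝒱.hom = 𝟙 S ∧ ∃ s : S, a.base s ∈ Ω ∧ 𝒱.hom.base (a.base s) = 𝒱.hom.base x) :
    IsIso L.shearRight :=
  L.isIso_shearRight (L.surjective_shearRight_of_isStrict hL hsec)

/-- **«… and `V′` is a group scheme»** ([Artin1986NeronModels] Lemma 2.5, conclusion; «the verification of the group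
axioms … as an exercise» = ★ W1d `isGroupChunkSolution_id`): a strict birational group law defined everywhere on
`𝒱 → S` (universally open, geometrically irreducible fibres, fibrewise-dense sections), given one section `e`, makes
`𝒱` a GROUP object of `Over S` whose multiplication restricts to `mul`, and `(𝒱, 𝟙)` is a group-chunk solution of `L`.
[cite: Artin1986NeronModels, Lemma 2.5 (p. 223)] [cite: EdixhovenRomagny, Thm. 3.18 (2) and (ii)-(iii)] -/
theorem exists_grpObj_of_isStrict_of_isIso_ι [IsIso L.dom.ι] [UniversallyOpen 𝒱.hom]
    [GeometricallyIrreducible 𝒱.hom] (hL : L.IsStrict)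
    (hsec : ∀ (x : 𝒱.left) (Ω : 𝒱.left.Opens), x ∈ Ω →
      ∃ a : S ⟶ 𝒱.left, a ≫ 𝒱.hom = 𝟙 S ∧ ∃ s : S, a.base s ∈ Ω ∧ 𝒱.hom.base (a.base s) = 𝒱.hom.base x)
    (e : 𝟙_ (Over S) ⟶ 𝒱) :
    ∃ _ : GrpObj 𝒱, L.dom.ι ≫ μ[𝒱].left = L.mul ∧ IsGroupChunkSolution L 𝒱 (𝟙 𝒱) :=
  L.isGroupChunkSolution_id (L.surjective_shearLeft_of_isStrict hL hsec)
    (L.surjective_shearRight_of_isStrict hL hsec) e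

end BirationalGroupLaw

end Literature.AlgebraicGeometry.GroupSchemes

end
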